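import Literature.RepresentationTheory.Kovacevic2021.SU21ModulesFromKTypes
import HarnessLib

/-!
# Kovačević's `SU(2,1)`-modules: the Casimir operator, and its vanishing on the six cohomological modules

Topic `RepresentationTheory/Kovacevic2021`; namespace `Literature.RepresentationTheory.Kovacevic2021`.
Sequel to `SU21ModulesFromKTypes`; definitions with bodies and theorems only, no named fact.

For a `K`-type datum `𝒟 : SU21Datum` [Kovacevic2021, §3 Def 1, Thm 1, Thm 2] the module `V = 𝒟.V`
carries the representation `ρ : 𝔤𝔩(3,ℂ) → End V` (`SU21Datum.ρ`, centre acting by `0`).  The **Casimir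
operator** of the trace form `(X, Y) ↦ tr(XY)` of `𝔤𝔩(3,ℂ)` (dual bases `{E_{ij}}`, `{E_{ji}}`) acts on
`V` by `Ω = ∑_{i,j} ρ(E_{ij}) ρ(E_{ji})` (`casimir`); since the centre acts trivially this is also the
Casimir operator of `𝔰𝔩(3,ℂ) = 𝔰𝔲(2,1)_ℂ` for the trace form [BorelWallach2000, II §2.3, §2.5;
Knapp2002, (5.24)–(5.25)].

## What is proved

* `casimir_eq_ops`: `Ω = (2/3)(H_α² + H_α H_β + H_β²) + (X_α Y_α + Y_α X_α) + (X_β Y_β + Y_β X_β)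
  + (X_{α+β} Y_{α+β} + Y_{α+β} X_{α+β})`;
* **`casimir_vec`** (any datum): `Ω u^k_{n,m} = c_{n,m} u^k_{n,m}` with
  `c_{n,m} = (n²-1)/2 + m²/6 + (n+1)(A_{n,m}D_{n+1,m+3} + B_{n,m}C_{n+1,m-3})
  + (n-1)(D_{n,m}A_{n-1,m-3} + C_{n,m}B_{n-1,m+3})` (`casimirScalar`; the `u^{k±1}_{n±2,m}`-components of
  the `β`- and `(α+β)`-terms cancel identically) — in particular `Ω` preserves
  every `K`-type and acts on `V_{n,m}` by the scalar `c_{n,m}` (`casimir_apply_of_mem_Ktype`); with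
  (b20), (b25): `c_{n,m} = (n²-1)/2 + m²/6 + nm + n² - 1 + 2n(n+1) A_{n,m}D_{n+1,m+3} - 2n(n-1) D_{n,m}A_{n-1,m-3}`
  (`casimirScalar_eq`);
* **the Casimir vanishes on the six cohomological modules** `U(0)`, `D₂ = U(0,6)`, `J_{1,0} = Z(3)`,
  `D₀ = U(0,-6)`, `J_{0,1} = Z(-3)`, `D₁ = W(3,0)` (`casimir_trivialMod`, `casimir_rayNE` / `casimir_raySE`
  for every ray datum with `e² = 9`, whence `casimir_holDS`, `casimir_ladderPlus`, `casimir_antiholDS`,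
  `casimir_ladderMinus`, and `casimir_midDS`): they have the infinitesimal character of the trivial
  representation, as cohomological modules must [BorelWallach2000, I 5.3 (Wigner), II 3.1; VI 4.8–4.11].
  This is the module-side input `σ(C) = 0` of the Casimir criterion II 3.1 (b) / 3.3 (tree:
  `BorelWallach2000/RelativeCohomologyCasimirCriterion`).

NOT here: `Ω` commutes with `ρ(𝔤𝔩₃)` for a general datum (it does, as the image of a central element of
`U(𝔤𝔩₃)`, `Literature/Algebra/Lie/CasimirElement`; not needed for the six modules, where `Ω = 0`).

## References

* D. Kovačević, Acta Math. Spalatensia 1 (2021) 105–125, §3 Def 1, Thm 1, Thm 2 ((b20)–(b30)), §4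
  (held: `paper:arxiv-1810.01752`, chunks p0005–p0011). [Kovacevic2021]
* A. Borel, N. Wallach (2000), II §2.3–2.5, Prop. 3.1, Cor. 3.3 (pp. 34–37, chunks p0059–p0062);
  VI 4.8–4.11 (pp. 130–133, chunks p0165–p0169). [BorelWallach2000]
* A. W. Knapp, *Lie Groups Beyond an Introduction* (2002), V §4 (5.24)–(5.25). [Knapp2002]
-/

noncomputable section

open Finsupp Module

namespace Literature.RepresentationTheory.Kovacevic2021

-- Mathlib idiom (Mathlib/Algebra/Lie/OfAssociative.lean): bracket on `Matrix`/`Module.End` = commutator.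
attribute [local instance 100] LieRing.ofAssociativeRing

namespace SU21Datum

variable (𝒟 : SU21Datum)

/-- The **Casimir operator** of the trace form of `𝔤𝔩(3,ℂ)` on `V`: `Ω = ∑_{i,j} ρ(E_{ij}) ρ(E_{ji})`.
[cite: BorelWallach2000, II §2.3] [cite: Knapp2002, V §4 (5.25)] -/
def casimir : Module.End ℂ 𝒟.V := ∑ i : Fin 3, ∑ j : Fin 3, 𝒟.ρfun (E i j) * 𝒟.ρfun (E j i)

/-- The scalar `c_{n,m}` by which `Ω` acts on the `K`-type `V_{n,m}` (raw form, before (b20)/(b25)):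
`(n²-1)/2 + m²/6 + (n+1)(A D' + B C') + (n-1)(D A'' + C B'')`. [cite: Kovacevic2021, §3 Thm 1, Thm 2] -/
def casimirScalar (n m : ℤ) : ℂ :=
  ((n : ℂ) ^ 2 - 1) / 2 + (m : ℂ) ^ 2 / 6
    + ((n : ℂ) + 1) * (𝒟.A n m * 𝒟.D (n + 1) (m + 3) + 𝒟.B n m * 𝒟.C (n + 1) (m - 3))
    + ((n : ℂ) - 1) * (𝒟.D n m * 𝒟.A (n - 1) (m - 3) + 𝒟.C n m * 𝒟.B (n - 1) (m + 3))

variable {𝒟}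

/-- reordering rule `H_β H_α = H_α H_β` from `[H_α, H_β] = 0` [cite: Kovacevic2021, §3 Thm 2] -/
private theorem Hb_mul_Ha : 𝒟.Hb * 𝒟.Ha = 𝒟.Ha * 𝒟.Hb := by
  have h := 𝒟.br_Ha_Hb
  have h' : ⁅𝒟.Ha, 𝒟.Hb⁆ = 𝒟.Ha * 𝒟.Hb - 𝒟.Hb * 𝒟.Ha := LinearMap.ext fun _ => rfl
  rw [h'] at h
  exact (sub_eq_zero.1 h).symm

variable (𝒟) in
/-- `Ω` in terms of the eight operators:
`Ω = (2/3)(H_α² + H_α H_β + H_β²) + X_αY_α + Y_αX_α + X_βY_β + Y_βX_β + X_{α+β}Y_{α+β} + Y_{α+β}X_{α+β}`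
(the diagonal part from `ρ(E₀₀) = (2H_α + H_β)/3`, `ρ(E₁₁) = (-H_α + H_β)/3`, `ρ(E₂₂) = -(H_α + 2H_β)/3`).
[cite: Knapp2002, V §4 (5.25)] -/
theorem casimir_eq_ops : 𝒟.casimir =
    (2 / 3 : ℂ) • (𝒟.Ha * 𝒟.Ha + 𝒟.Ha * 𝒟.Hb + 𝒟.Hb * 𝒟.Hb)
      + (𝒟.Xa * 𝒟.Ya + 𝒟.Ya * 𝒟.Xa) + (𝒟.Xb * 𝒟.Yb + 𝒟.Yb * 𝒟.Xb)
      + (𝒟.Xab * 𝒟.Yab + 𝒟.Yab * 𝒟.Xab) := by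
  simp only [casimir, Fin.sum_univ_three, ρfun_E, smul_add, add_mul, mul_add, smul_mul_assoc,
    mul_smul_comm, smul_smul, Hb_mul_Ha]
  module

/-- the products of `End V` evaluated [folklore] -/
private theorem end_mul_apply (P Q : Module.End ℂ 𝒟.V) (v : 𝒟.V) : (P * Q) v = P (Q v) := rfl

-- One fixed expansion step (the eight action lemmas, vanishing of `vec` off range by `omega`, linear
-- bookkeeping) at each of the four boundary cases `k = 1 ∨ k ≥ 2`, `k = n ∨ k < n`; which simp lemmas
-- fire varies with the case, so the unused-simp-argument linter is off for this one declaration.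
variable (𝒟) in
set_option linter.unusedSimpArgs false in
/-- **The Casimir on the basis**: `Ω u^k_{n,m} = c_{n,m} u^k_{n,m}` for every admissible label; the
`u^{k±1}_{n±2,m}`-components of the `β`- and `(α+β)`-terms cancel identically, and the coefficient of
`u^k_{n,m}` is independent of `k` (the `𝔰𝔩₂(α)`-Casimir `X_αY_α + Y_αX_α + H_α²/2 = (n²-1)/2` on `V_{n,m}`).
[cite: Kovacevic2021, §3 Thm 1] [cite: BorelWallach2000, II §2.5] -/
theorem casimir_vec {n m k : ℤ} (hS : (n, m) ∈ 𝒟.S) (hk : 1 ≤ k) (hkn : k ≤ n) :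
    𝒟.casimir (𝒟.vec n m k) = 𝒟.casimirScalar n m • 𝒟.vec n m k := by
  rw [casimir_eq_ops, casimirScalar]
  rcases eq_or_lt_of_le hk with rfl | hk2 <;> rcases (eq_or_lt_of_le hkn).imp Eq.symm id with rfl | hkn2
  all_goals
    simp (disch := omega) only [end_mul_apply, LinearMap.sub_apply, LinearMap.add_apply, LinearMap.neg_apply,
      LinearMap.smul_apply, LinearMap.zero_apply, map_add, map_sub, map_neg, map_smul, map_zero, smul_zero, Ha_vec,
      Hb_vec, Xa_vec, Ya_vec, Xab_vec, Xb_vec, Yab_vec, Yb_vec, vec_of_not_range, smul_add, smul_sub, smul_neg,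
      smul_smul, neg_smul, neg_neg, sub_add_cancel, add_sub_cancel_right, Int.cast_add, Int.cast_sub, Int.cast_one,
      Int.cast_ofNat, Int.cast_zero, add_zero, zero_add]
  all_goals match_scalars <;> ring1

variable (𝒟) in
/-- `Ω` acts on the whole `K`-type `V_{n,m}` by the scalar `c_{n,m}` (in particular it preserves the
`K`-types). [cite: BorelWallach2000, II §2.5] [cite: Kovacevic2021, §3 Thm 1] -/
theorem casimir_apply_of_mem_Ktype {n m : ℤ} {v : 𝒟.V} (hv : v ∈ 𝒟.Ktype n m) :
    𝒟.casimir v = 𝒟.casimirScalar n m • v := by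
  refine Submodule.span_induction (p := fun v _ => 𝒟.casimir v = 𝒟.casimirScalar n m • v) ?_
    (by simp) (fun x y _ _ hx hy => by rw [map_add, hx, hy, smul_add])
    (fun c x _ hx => by rw [map_smul, hx, smul_comm]) hv
  rintro _ ⟨k, rfl⟩
  by_cases h : (n, m) ∈ 𝒟.S ∧ 1 ≤ k ∧ k ≤ n
  · exact 𝒟.casimir_vec h.1 h.2.1 h.2.2
  · simp only [vec_of_neg n m k h, map_zero, smul_zero]

variable (𝒟) in
/-- **The Casimir scalar, simplified by (b20) and (b25)**:
`c_{n,m} = (n²-1)/2 + m²/6 + nm + n² - 1 + 2n(n+1) A_{n,m}D_{n+1,m+3} - 2n(n-1) D_{n,m}A_{n-1,m-3}` on `S`.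
[cite: Kovacevic2021, §3 Thm 2 (b20), (b25)] -/
theorem casimirScalar_eq {n m : ℤ} (hS : (n, m) ∈ 𝒟.S) :
    𝒟.casimirScalar n m = ((n : ℂ) ^ 2 - 1) / 2 + (m : ℂ) ^ 2 / 6 + n * m + (n : ℂ) ^ 2 - 1
      + 2 * n * ((n : ℂ) + 1) * (𝒟.A n m * 𝒟.D (n + 1) (m + 3))
      - 2 * n * ((n : ℂ) - 1) * (𝒟.D n m * 𝒟.A (n - 1) (m - 3)) := by
  rw [casimirScalar]
  linear_combination (-1 : ℂ) * 𝒟.rel20 hS + (2 * (n : ℂ) + 1) * 𝒟.rel25 hS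

/-! ### The Casimir vanishes on the six cohomological modules -/

/-- `Ω = 0` on the trivial module `U(0) = J_{0,0}`. [cite: BorelWallach2000, VI 4.8, II Cor. 3.2] -/
theorem casimir_trivialMod : trivialMod.casimir = 0 := by
  refine ext_vec fun n m k hS hk hkn => ?_
  rw [LinearMap.zero_apply, trivialMod.casimir_vec hS hk hkn, trivialMod.casimirScalar_eq hS]
  apply smul_eq_zero_of_left
  have hS' : n = 1 ∧ m = 0 := by simpa [trivialMod] using hS
  obtain ⟨rfl, rfl⟩ := hS'
  have hA : ∀ a b : ℤ, trivialMod.A a b = 0 := fun _ _ => rfl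
  have hD : ∀ a b : ℤ, trivialMod.D a b = 0 := fun _ _ => rfl
  simp only [hA, hD, mul_zero, add_zero, sub_zero]
  push_cast
  ring

/-- `Ω = 0` on every north-east ray datum `rayNE e n₀` with `e² = 9` (the rays `U(l,2t)`/`Z(s)` through
the cohomological region: `D₂ = U(0,6)` and `J_{1,0} = Z(3)`): above the bottom `K`-type the scalar is
`e²/6 - 3/2`, at the bottom it is `e²/6 - 3/2 - n₀(n₀-1)(2n₀+e-1) = -n₀ · (2n₀² + (e-3)n₀ + 1 - e) = 0`.
[cite: Kovacevic2021, §3 Thm 3 (b75), §4] [cite: BorelWallach2000, VI Thm 4.11] -/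
theorem casimir_rayNE (e n₀ : ℤ) (h₀ : 1 ≤ n₀) (h : 2 * n₀ ^ 2 + (e - 3) * n₀ + (1 - e) = 0)
    (he : e ^ 2 = 9) : (rayNE e n₀ h₀ h).casimir = 0 := by
  refine ext_vec fun n m k hS hk hkn => ?_
  rw [LinearMap.zero_apply, (rayNE e n₀ h₀ h).casimir_vec hS hk hkn, (rayNE e n₀ h₀ h).casimirScalar_eq hS]
  apply smul_eq_zero_of_left
  obtain ⟨hn, hm⟩ := hS
  change n₀ ≤ n at hn
  change m = 3 * n + e at hm
  subst hm
  have heC : (e : ℂ) ^ 2 = 9 := by exact_mod_cast he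
  have hA : ∀ a b : ℤ, (rayNE e n₀ h₀ h).A a b =
      if n₀ ≤ a ∧ b = 3 * a + e then -(2 * (a : ℂ) + e + 1) / 2 else 0 := fun _ _ => rfl
  have hD : ∀ a b : ℤ, (rayNE e n₀ h₀ h).D a b = if n₀ + 1 ≤ a ∧ b = 3 * a + e then 1 else 0 :=
    fun _ _ => rfl
  rw [hA, hA, hD, hD, if_pos ⟨hn, rfl⟩, if_pos ⟨by omega, by ring⟩]
  by_cases h1 : n₀ + 1 ≤ n
  · rw [if_pos ⟨h1, rfl⟩, if_pos ⟨by omega, by ring⟩]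
    push_cast
    linear_combination (1 / 6 : ℂ) * heC
  · obtain rfl : n = n₀ := le_antisymm (by omega) hn
    rw [if_neg fun h' => h1 h'.1, zero_mul, mul_zero, sub_zero]
    have hc : 2 * (n : ℂ) ^ 2 + ((e : ℂ) - 3) * n + (1 - e) = 0 := by exact_mod_cast h
    push_cast
    linear_combination (1 / 6 : ℂ) * heC - (n : ℂ) * hc

/-- `Ω = 0` on every south-east ray datum `raySE e n₀` with `e² = 9` (`D₀ = U(0,-6)`, `J_{0,1} = Z(-3)`):
here `A = D = 0` and the scalar is `e²/6 - 3/2` throughout.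
[cite: Kovacevic2021, §3 Thm 3 (b80), §4] [cite: BorelWallach2000, VI Thm 4.11] -/
theorem casimir_raySE (e n₀ : ℤ) (h₀ : 1 ≤ n₀) (h : 2 * n₀ ^ 2 + (e - 3) * n₀ + (1 - e) = 0)
    (he : e ^ 2 = 9) : (raySE e n₀ h₀ h).casimir = 0 := by
  refine ext_vec fun n m k hS hk hkn => ?_
  rw [LinearMap.zero_apply, (raySE e n₀ h₀ h).casimir_vec hS hk hkn, (raySE e n₀ h₀ h).casimirScalar_eq hS]
  apply smul_eq_zero_of_left
  obtain ⟨-, hm⟩ := hS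
  change m = -(3 * n + e) at hm
  subst hm
  have heC : (e : ℂ) ^ 2 = 9 := by exact_mod_cast he
  have hA : ∀ a b : ℤ, (raySE e n₀ h₀ h).A a b = 0 := fun _ _ => rfl
  have hD : ∀ a b : ℤ, (raySE e n₀ h₀ h).D a b = 0 := fun _ _ => rfl
  simp only [hA, hD, mul_zero, add_zero, sub_zero]
  push_cast
  linear_combination (1 / 6 : ℂ) * heC

/-- `Ω = 0` on `D₂`, the holomorphic discrete series with infinitesimal character `ρ`.
[cite: BorelWallach2000, VI 4.10, II Prop. 3.1] -/
theorem casimir_holDS : holDS.casimir = 0 := casimir_rayNE 3 1 le_rfl (by norm_num) (by norm_num)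

/-- `Ω = 0` on `J_{1,0} = Z(3)`. [cite: BorelWallach2000, VI Thm 4.11 (3), II Prop. 3.1] -/
theorem casimir_ladderPlus : ladderPlus.casimir = 0 := casimir_rayNE (-3) 2 (by norm_num) (by norm_num) (by norm_num)

/-- `Ω = 0` on `D₀`, the antiholomorphic discrete series. [cite: BorelWallach2000, VI 4.10, II Prop. 3.1] -/
theorem casimir_antiholDS : antiholDS.casimir = 0 := casimir_raySE 3 1 le_rfl (by norm_num) (by norm_num)

/-- `Ω = 0` on `J_{0,1} = Z(-3)`. [cite: BorelWallach2000, VI Thm 4.11 (3), II Prop. 3.1] -/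
theorem casimir_ladderMinus : ladderMinus.casimir = 0 :=
  casimir_raySE (-3) 2 (by norm_num) (by norm_num) (by norm_num)

/-- a complex number equal to a non-zero natural number is non-zero [folklore] -/
private theorem ne_zero_of_eq_natCast' {x : ℂ} (a : ℕ) (h : x = a) (ha : a ≠ 0) : x ≠ 0 := by
  rw [h]; exact_mod_cast ha

/-- the non-vanishing denominators at a point of the cone of `D₁` [folklore] -/
private theorem mid_denoms' {n : ℤ} (p q : ℕ) (hn : n = 3 + p + q) :
    (n : ℂ) ≠ 0 ∧ (n : ℂ) + 1 ≠ 0 ∧ (n : ℂ) - 1 ≠ 0 ∧ (n : ℂ) - 1 - 1 ≠ 0 := by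
  have hnC : (n : ℂ) = 3 + p + q := by exact_mod_cast hn
  refine ⟨ne_zero_of_eq_natCast' (3 + p + q) (by rw [hnC]; push_cast; ring) (by omega),
    ne_zero_of_eq_natCast' (4 + p + q) (by rw [hnC]; push_cast; ring) (by omega),
    ne_zero_of_eq_natCast' (2 + p + q) (by rw [hnC]; push_cast; ring) (by omega),
    ne_zero_of_eq_natCast' (1 + p + q) (by rw [hnC]; push_cast; ring) (by omega)⟩

/-- `Ω = 0` on `D₁ = W(3,0)`: at the cone point `(p,q)` the scalar is
`(n²-1)/2 + m²/6 + nm + n² - 1 - 2(p+1)(p+2)(p+3) + 2p(p+1)(p+2)` with `n = 3+p+q`, `m = 3p-3q`, which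
vanishes identically. [cite: Kovacevic2021, §3 Thm 3 (b85), (b100), §4] [cite: BorelWallach2000, VI 4.10] -/
theorem casimir_midDS : midDS.casimir = 0 := by
  refine ext_vec fun n m k hS hk hkn => ?_
  rw [LinearMap.zero_apply, midDS.casimir_vec hS hk hkn, midDS.casimirScalar_eq hS]
  apply smul_eq_zero_of_left
  obtain ⟨p, q, hn, hm⟩ := hS
  change n = 3 + p + q at hn
  change m = 3 * p - 3 * q at hm
  have hnC : (n : ℂ) = 3 + p + q := by exact_mod_cast hn
  have hmC : (m : ℂ) = 3 * p - 3 * q := by exact_mod_cast hm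
  obtain ⟨h0, h1, h1', -⟩ := mid_denoms' p q hn
  have hA : ∀ a b : ℤ, midDS.A a b = midA a b := fun _ _ => rfl
  have hD : ∀ a b : ℤ, midDS.D a b = midD a b := fun _ _ => rfl
  rw [hA, hA, hD, hD, midA_eq p q hn hm, midD_eq (p + 1) q (by omega) (by omega), midD_eq p q hn hm]
  push_cast
  simp only [add_sub_cancel_right]
  rcases Nat.eq_zero_or_pos p with rfl | hp
  · simp only [Nat.cast_zero, zero_div, zero_mul, mul_zero, sub_zero]
    field_simp
    rw [hmC, hnC]
    push_cast
    ring
  · obtain ⟨p', rfl⟩ := Nat.exists_eq_add_one_of_ne_zero (by omega : p ≠ 0)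
    rw [midA_eq p' q (n := n - 1) (m := m - 3) (by omega) (by omega)]
    field_simp
    rw [hmC, hnC]
    push_cast
    ring

end SU21Datum

end Literature.RepresentationTheory.Kovacevic2021
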